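import Mathlib
import HarnessLib

/-!
# The polar-angle map `θ ↦ θ − κ sin θ` of the leading-order trivializing kick: a strictly increasing bijection of `[0, π]` for `|κ| ≤ 1`, a fold for `κ > 1`

HONEST FRAMING: exact (Metropolis-corrected) sampling algorithms for lattice gauge theory;
figures of merit are autocorrelation/cost numbers at stated couplings and volumes; no
continuum-physics claim.

Venture `LatticeQCDFlow` (cell pub-lqcd), topic `Exactness`; FANOUT row 7 (`s0-cpn-null`: the
S0-D1 rung — 2D CP⁹, Lüscher's leading-order (LO) trivializing map INSIDE the HMC algorithm
("THMC") versus plain HMC, the Engel–Schaefer 2011 null test).  NEW WORK of the cell over Mathlib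
(trigonometric bounds `Real.abs_sin_lt_abs`, `Real.sin_gt_sub_cube`, `Real.one_sub_sq_div_two_lt_cos`,
the intermediate value theorem); nothing is cited as a fact.  Printed counterparts, NAMED ONLY:
Engel–Schaefer, Comput. Phys. Commun. 182 (2011) 2107, §3 eqs. (15)–(18) (the single-site Euler step
of the LO flow on `S^{2N−1}`, its per-site Jacobian `det 𝒥 = (dθ/dθ')(sin θ/sin θ')^{2N−2}` with
`θ` the angle to the local field, and the two printed values of the map constant); Lüscher 2010 §3.

## The object

One Euler step of the LO flow at one site moves the unit site vector `x' ∈ S^n ⊂ ℝ^{n+1}`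
(`n = 2N − 1`) along the great circle through `x'` and the local-field direction `Ĵ`, towards `Ĵ`,
by the arc `α = κ sin θ'`, where `θ'` is the angle between `J` and `x'` and `κ = ε_s c ‖J‖`
(`Exactness/SphereGeodesicKick.lean` derives this from the printed vector formula).  In the polar
angle measured from `Ĵ` the step is therefore the ONE-DIMENSIONAL map

  `kickAngle κ θ' = θ' − κ sin θ'`,

the direction orthogonal to `Ĵ` being untouched.  Bijectivity of the site map is bijectivity of
`kickAngle κ` on `[0, π]`; this file settles it (yes iff `|κ| ≤ 1`, with an explicit fold for
`κ > 1`).  The Jacobian against the polar law `sin^{n−1}θ dθ` (E–S eq. (18)) is the companion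
`Exactness/KickAngleJacobian.lean`.

## Content

* `kickAngle κ θ = θ − κ sin θ`; `kickAngle_zero/_pi` (the poles are fixed), `hasDerivAt_kickAngle`
  (`dθ/dθ' = 1 − κ cos θ'`, the first factor of E–S eq. (18)), continuity/measurability;
  `abs_sin_sub_sin_lt` (`|sin a − sin b| < |a − b|` for `a ≠ b`).
* **`strictMono_kickAngle`** — for `|κ| ≤ 1` the map is strictly increasing on `ℝ`, hence
  injective; `kickAngle_mem_Icc/_mem_Ioo`, **`image_kickAngle_Icc`** (`= [0, π]`, intermediate
  value theorem), **`bijOn_kickAngle`** / `bijOn_kickAngle_Ioo`: a bijection of `[0, π]` (and of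
  `(0, π)`) onto itself — the site map is a bijection of the sphere whenever `κ = ε_s c ‖J‖ ≤ 1`;
  `one_sub_mul_cos_nonneg/_pos` (`dθ/dθ' ≥ 0`, `> 0` for `|κ| < 1`); `kickAngle_add_two_pi`,
  `surjective_kickAngle` (a homeomorphism of `ℝ`).
* **`exists_deriv_neg`**, **`kickAngle_fold`** — for `κ > 1` the map FOLDS: at
  `θ = (κ − 1)/κ² ∈ (0, π)` the first Jacobian factor is NEGATIVE (`1 − κ cos θ < 0`) and the
  kicked angle overshoots the pole (`−π < kickAngle κ θ < 0`); hence there are `θ₁ ≠ θ₂` in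
  `(0, π)` with `kickAngle κ θ₂ = −kickAngle κ θ₁` — two start angles on opposite meridians with
  the same image point (`Exactness/SphereGeodesicKick.lean` makes the two sphere points explicit).
  This is the typed form of the census criterion of the cell's reference implementation
  (CANARY-C8: "fraction of sites with `1 − ε_s c J·x' ≤ 0` / with `ε_s c |J| ≥ 1` — `θ' ↦ θ` not
  monotone"), by which the constant printed in E–S eq. (16) was found to make the site map
  non-bijective at the printed flow times while eq. (15)/(18)'s constant does not; row 7
  pre-registered the latter.  For `ε_s c ‖J‖ > 1` no Jacobian can make the field-transformed
  update exact, since the map is not injective.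

NOT CLAIMED: anything about the sphere measure (see `KickAngleJacobian.lean`,
`SphereGeodesicKick.lean`); several Euler steps; autocorrelations.
-/

noncomputable section

namespace Summit.Ventures.LatticeQCDFlow.Exactness

open Real Set Filter
open scoped Topology

/-! ## The angle map and its derivative -/

/-- The polar-angle map of the single-site LO kick: `θ ↦ θ − κ sin θ` (`κ = ε_s c ‖J‖`). -/
def kickAngle (κ θ : ℝ) : ℝ := θ - κ * sin θ

/-- The pole `θ = 0` is fixed. -/
@[simp] theorem kickAngle_zero (κ : ℝ) : kickAngle κ 0 = 0 := by simp [kickAngle]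

/-- The pole `θ = π` is fixed. -/
@[simp] theorem kickAngle_pi (κ : ℝ) : kickAngle κ π = π := by simp [kickAngle]

/-- No kick at `κ = 0`. -/
@[simp] theorem kickAngle_zero_left (θ : ℝ) : kickAngle 0 θ = θ := by simp [kickAngle]

/-- Unfolding lemma. -/
theorem kickAngle_apply (κ θ : ℝ) : kickAngle κ θ = θ - κ * sin θ := rfl

/-- `d(kickAngle κ)/dθ = 1 − κ cos θ` — the first factor of E–S eq. (18). -/
theorem hasDerivAt_kickAngle (κ θ : ℝ) : HasDerivAt (kickAngle κ) (1 - κ * cos θ) θ := by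
  show HasDerivAt (fun x => x - κ * sin x) (1 - κ * cos θ) θ
  exact (hasDerivAt_id' θ).sub ((hasDerivAt_sin θ).const_mul κ)

/-- The angle map is continuous. -/
theorem continuous_kickAngle (κ : ℝ) : Continuous (kickAngle κ) :=
  continuous_id.sub (continuous_const.mul continuous_sin)

/-- The angle map is measurable. -/
theorem measurable_kickAngle (κ : ℝ) : Measurable (kickAngle κ) :=
  (continuous_kickAngle κ).measurable

/-- Strict form of the sine's Lipschitz bound: `|sin a − sin b| < |a − b|` for `a ≠ b`. -/
theorem abs_sin_sub_sin_lt {a b : ℝ} (h : a ≠ b) : |sin a - sin b| < |a - b| := by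
  rw [sin_sub_sin]
  have h2 : (a - b) / 2 ≠ 0 := by
    intro h0
    exact h (by linarith)
  have hs : |sin ((a - b) / 2)| < |(a - b) / 2| := abs_sin_lt_abs h2
  have hc : |cos ((a + b) / 2)| ≤ 1 := abs_cos_le_one _
  calc |2 * sin ((a - b) / 2) * cos ((a + b) / 2)|
        = 2 * |sin ((a - b) / 2)| * |cos ((a + b) / 2)| := by
          rw [abs_mul, abs_mul, abs_two]
    _ ≤ 2 * |sin ((a - b) / 2)| * 1 := by gcongr
    _ < 2 * |(a - b) / 2| * 1 := by gcongr
    _ = |a - b| := by rw [abs_div, abs_two]; ring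

/-! ## `|κ| ≤ 1`: a strictly increasing bijection of `[0, π]` -/

/-- **For `|κ| ≤ 1` the angle map is strictly increasing** (so the site map is injective). -/
theorem strictMono_kickAngle {κ : ℝ} (hκ : |κ| ≤ 1) : StrictMono (kickAngle κ) := by
  intro a b hab
  simp only [kickAngle]
  have h1 : |κ * (sin b - sin a)| < b - a := by
    calc |κ * (sin b - sin a)| = |κ| * |sin b - sin a| := abs_mul _ _
      _ ≤ |sin b - sin a| := mul_le_of_le_one_left (abs_nonneg _) hκ
      _ < |b - a| := abs_sin_sub_sin_lt hab.ne'
      _ = b - a := abs_of_pos (sub_pos.2 hab)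
  have h2 := (abs_lt.1 h1).2
  linarith

/-- For `|κ| ≤ 1` the angle map is injective. -/
theorem injective_kickAngle {κ : ℝ} (hκ : |κ| ≤ 1) : Function.Injective (kickAngle κ) :=
  (strictMono_kickAngle hκ).injective

/-- `dθ/dθ' = 1 − κ cos θ' ≥ 0` for `|κ| ≤ 1`. -/
theorem one_sub_mul_cos_nonneg {κ : ℝ} (hκ : |κ| ≤ 1) (θ : ℝ) : 0 ≤ 1 - κ * cos θ := by
  have h : κ * cos θ ≤ 1 := by
    calc κ * cos θ ≤ |κ * cos θ| := le_abs_self _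
      _ = |κ| * |cos θ| := abs_mul _ _
      _ ≤ 1 * 1 := mul_le_mul hκ (abs_cos_le_one _) (abs_nonneg _) zero_le_one
      _ = 1 := one_mul _
  linarith

/-- `dθ/dθ' = 1 − κ cos θ' > 0` for `|κ| < 1`. -/
theorem one_sub_mul_cos_pos {κ : ℝ} (hκ : |κ| < 1) (θ : ℝ) : 0 < 1 - κ * cos θ := by
  have h : κ * cos θ < 1 := by
    calc κ * cos θ ≤ |κ * cos θ| := le_abs_self _
      _ = |κ| * |cos θ| := abs_mul _ _
      _ ≤ |κ| * 1 := mul_le_mul_of_nonneg_left (abs_cos_le_one _) (abs_nonneg _)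
      _ < 1 := by rw [mul_one]; exact hκ
  linarith

/-- `[0, π]` is mapped into `[0, π]` (`|κ| ≤ 1`). -/
theorem kickAngle_mem_Icc {κ : ℝ} (hκ : |κ| ≤ 1) {θ : ℝ} (hθ : θ ∈ Icc 0 π) :
    kickAngle κ θ ∈ Icc 0 π := by
  have hm := (strictMono_kickAngle hκ).monotone
  refine ⟨?_, ?_⟩
  · have h := hm hθ.1
    rwa [kickAngle_zero] at h
  · have h := hm hθ.2
    rwa [kickAngle_pi] at h

/-- `(0, π)` is mapped into `(0, π)` (`|κ| ≤ 1`). -/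
theorem kickAngle_mem_Ioo {κ : ℝ} (hκ : |κ| ≤ 1) {θ : ℝ} (hθ : θ ∈ Ioo 0 π) :
    kickAngle κ θ ∈ Ioo 0 π := by
  have hm := strictMono_kickAngle hκ
  refine ⟨?_, ?_⟩
  · have h := hm hθ.1
    rwa [kickAngle_zero] at h
  · have h := hm hθ.2
    rwa [kickAngle_pi] at h

/-- **The image of `[0, π]` is `[0, π]`** (poles fixed + intermediate value theorem). -/
theorem image_kickAngle_Icc {κ : ℝ} (hκ : |κ| ≤ 1) : kickAngle κ '' Icc 0 π = Icc 0 π := by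
  refine Subset.antisymm ?_ ?_
  · rintro _ ⟨θ, hθ, rfl⟩
    exact kickAngle_mem_Icc hκ hθ
  · have h := intermediate_value_Icc pi_pos.le (continuous_kickAngle κ).continuousOn
    rwa [kickAngle_zero, kickAngle_pi] at h

/-- The image of `(0, π)` is `(0, π)`. -/
theorem image_kickAngle_Ioo {κ : ℝ} (hκ : |κ| ≤ 1) : kickAngle κ '' Ioo 0 π = Ioo 0 π := by
  refine Subset.antisymm ?_ ?_
  · rintro _ ⟨θ, hθ, rfl⟩
    exact kickAngle_mem_Ioo hκ hθ
  · intro y hy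
    have hy' : y ∈ kickAngle κ '' Icc 0 π := by
      rw [image_kickAngle_Icc hκ]
      exact Ioo_subset_Icc_self hy
    obtain ⟨θ, hθ, rfl⟩ := hy'
    refine ⟨θ, ⟨lt_of_le_of_ne hθ.1 ?_, lt_of_le_of_ne hθ.2 ?_⟩, rfl⟩
    · rintro rfl
      rw [kickAngle_zero] at hy
      exact lt_irrefl _ hy.1
    · rintro rfl
      rw [kickAngle_pi] at hy
      exact lt_irrefl _ hy.2

/-- **`kickAngle κ` is a bijection of `[0, π]` onto itself for `|κ| ≤ 1`** — the single-site LO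
map is then a bijection of the sphere (polar angle bijective, equatorial direction fixed). -/
theorem bijOn_kickAngle {κ : ℝ} (hκ : |κ| ≤ 1) : BijOn (kickAngle κ) (Icc 0 π) (Icc 0 π) :=
  ⟨fun _ hθ => kickAngle_mem_Icc hκ hθ, (injective_kickAngle hκ).injOn,
    fun y hy => by rw [image_kickAngle_Icc hκ]; exact hy⟩

/-- … and of `(0, π)` onto itself. -/
theorem bijOn_kickAngle_Ioo {κ : ℝ} (hκ : |κ| ≤ 1) : BijOn (kickAngle κ) (Ioo 0 π) (Ioo 0 π) :=
  ⟨fun _ hθ => kickAngle_mem_Ioo hκ hθ, (injective_kickAngle hκ).injOn,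
    fun y hy => by rw [image_kickAngle_Ioo hκ]; exact hy⟩

/-- `kickAngle κ (θ + 2π) = kickAngle κ θ + 2π`; with strict monotonicity and continuity this
makes `kickAngle κ` a self-homeomorphism of `ℝ` for `|κ| ≤ 1` (`surjective_kickAngle`). -/
theorem kickAngle_add_two_pi (κ θ : ℝ) : kickAngle κ (θ + 2 * π) = kickAngle κ θ + 2 * π := by
  simp only [kickAngle, sin_add_two_pi]
  ring

/-- `θ − |κ| ≤ kickAngle κ θ ≤ θ + |κ|`. -/
theorem kickAngle_mem_Icc_sub_add (κ θ : ℝ) : kickAngle κ θ ∈ Icc (θ - |κ|) (θ + |κ|) := by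
  have h : |κ * sin θ| ≤ |κ| := by
    rw [abs_mul]
    exact mul_le_of_le_one_right (abs_nonneg _) (abs_sin_le_one _)
  simp only [kickAngle, mem_Icc]
  constructor <;> linarith [(abs_le.1 h).1, (abs_le.1 h).2]

/-- For `|κ| ≤ 1`, `kickAngle κ : ℝ → ℝ` is surjective (hence a strictly increasing continuous
bijection of `ℝ`). -/
theorem surjective_kickAngle (κ : ℝ) : Function.Surjective (kickAngle κ) := by
  refine (continuous_kickAngle κ).surjective ?_ ?_
  · refine tendsto_atTop_mono (fun θ => (kickAngle_mem_Icc_sub_add κ θ).1) ?_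
    exact tendsto_atTop_add_const_right _ _ tendsto_id
  · refine tendsto_atBot_mono (fun θ => (kickAngle_mem_Icc_sub_add κ θ).2) ?_
    exact tendsto_atBot_add_const_right _ _ tendsto_id

/-! ## `κ > 1`: the map folds (a negative Jacobian factor and two start angles with mirror images) -/

/-- For `κ > 1` there is an angle `θ ∈ (0, π)` (explicitly `θ = (κ − 1)/κ²`) at which the first
Jacobian factor is NEGATIVE, `1 − κ cos θ < 0`, and the kicked angle overshoots the pole by less
than `π`: `−π < kickAngle κ θ < 0`. -/
theorem exists_deriv_neg {κ : ℝ} (hκ : 1 < κ) :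
    ∃ θ ∈ Ioo 0 π, 1 - κ * cos θ < 0 ∧ kickAngle κ θ < 0 ∧ -π < kickAngle κ θ := by
  have hκ0 : 0 < κ := zero_lt_one.trans hκ
  set θ : ℝ := (κ - 1) / κ ^ 2 with hθdef
  have hθpos : 0 < θ := div_pos (by linarith) (by positivity)
  have hθκ : θ * κ ^ 2 = κ - 1 := by
    rw [hθdef]
    field_simp
  -- `θ ≤ (κ − 1)/κ = δ` and `θ < 1`
  have hθle : θ ≤ (κ - 1) / κ := by
    rw [hθdef, div_le_div_iff₀ (by positivity) hκ0]
    apply mul_le_mul_of_nonneg_left _ (by linarith)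
    nlinarith
  have hδlt : (κ - 1) / κ < 1 := by
    rw [div_lt_one hκ0]
    linarith
  have hθlt1 : θ < 1 := hθle.trans_lt hδlt
  have hθltpi : θ < π := hθlt1.trans (by linarith [pi_gt_three])
  -- `θ² ≤ θ ≤ δ`
  have hθsq : θ ^ 2 ≤ (κ - 1) / κ := by
    calc θ ^ 2 = θ * θ := sq θ
      _ ≤ θ * 1 := mul_le_mul_of_nonneg_left hθlt1.le hθpos.le
      _ = θ := mul_one θ
      _ ≤ (κ - 1) / κ := hθle
  have hδ : κ * (1 - (κ - 1) / κ) = 1 := by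
    field_simp
    ring
  refine ⟨θ, ⟨hθpos, hθltpi⟩, ?_, ?_, ?_⟩
  · -- `cos θ > 1 − θ²/2 ≥ 1 − δ/2 > 1 − δ = 1/κ`
    have hc : 1 - θ ^ 2 / 2 < cos θ := one_sub_sq_div_two_lt_cos hθpos.ne'
    have h1 : κ * (1 - θ ^ 2 / 2) ≥ 1 := by
      have : 1 - θ ^ 2 / 2 ≥ 1 - (κ - 1) / κ := by linarith
      calc κ * (1 - θ ^ 2 / 2) ≥ κ * (1 - (κ - 1) / κ) :=
            mul_le_mul_of_nonneg_left this hκ0.le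
        _ = 1 := hδ
    have h2 : κ * (1 - θ ^ 2 / 2) < κ * cos θ := mul_lt_mul_of_pos_left hc hκ0
    linarith
  · -- `sin θ > θ − θ³/6 ≥ θ (1 − δ) = θ/κ`
    have hs : θ - θ ^ 3 / 6 < sin θ := sin_gt_sub_cube hθpos
    have h1 : κ * (θ - θ ^ 3 / 6) ≥ θ := by
      have hθ2 : θ ^ 2 / 6 ≤ (κ - 1) / κ := by
        have : θ ^ 2 / 6 ≤ θ ^ 2 := by nlinarith [sq_nonneg θ]
        exact this.trans hθsq
      have : θ - θ ^ 3 / 6 = θ * (1 - θ ^ 2 / 6) := by ring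
      rw [this]
      calc κ * (θ * (1 - θ ^ 2 / 6)) = θ * (κ * (1 - θ ^ 2 / 6)) := by ring
        _ ≥ θ * (κ * (1 - (κ - 1) / κ)) := by
            apply mul_le_mul_of_nonneg_left _ hθpos.le
            exact mul_le_mul_of_nonneg_left (by linarith) hκ0.le
        _ = θ := by rw [hδ, mul_one]
    have h2 : κ * (θ - θ ^ 3 / 6) < κ * sin θ := mul_lt_mul_of_pos_left hs hκ0
    simp only [kickAngle]
    linarith
  · -- `kickAngle κ θ ≥ θ − κ θ = −(κ − 1) θ = −(κ−1)²/κ² > −1 > −π`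
    have hs : sin θ ≤ θ := sin_le hθpos.le
    have h1 : κ * sin θ ≤ κ * θ := mul_le_mul_of_nonneg_left hs hκ0.le
    have h2 : (κ - 1) * θ < 1 := by
      have : (κ - 1) * θ = (κ - 1) ^ 2 / κ ^ 2 := by
        rw [hθdef]
        field_simp
      rw [this, div_lt_one (by positivity)]
      nlinarith
    simp only [kickAngle]
    linarith [pi_gt_three]

/-- **The fold.**  For `κ > 1` there are two DISTINCT angles `θ₁, θ₂ ∈ (0, π)` whose kicked angles
are mirror images, `kickAngle κ θ₂ = − kickAngle κ θ₁` with `kickAngle κ θ₁ < 0 < kickAngle κ θ₂`: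
the start point at polar angle `θ₁` overshoots the pole and lands where the start point at `θ₂` on
the OPPOSITE meridian lands (`Exactness/SphereGeodesicKick.lean` makes the two sphere points
explicit).  So for `ε_s c ‖J‖ > 1` the single-site map is not injective and no Jacobian can make
the field-transformed update exact. -/
theorem kickAngle_fold {κ : ℝ} (hκ : 1 < κ) :
    ∃ θ₁ ∈ Ioo 0 π, ∃ θ₂ ∈ Ioo 0 π, θ₁ ≠ θ₂ ∧ kickAngle κ θ₂ = -kickAngle κ θ₁ ∧
      kickAngle κ θ₁ < 0 := by
  obtain ⟨θ₁, hθ₁, _, hneg, hgt⟩ := exists_deriv_neg hκ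
  -- IVT on `[θ₁, π]`: `kickAngle κ θ₁ < 0 < −kickAngle κ θ₁ < π = kickAngle κ π`
  have hcont : ContinuousOn (kickAngle κ) (Icc θ₁ π) := (continuous_kickAngle κ).continuousOn
  have hivt := intermediate_value_Icc hθ₁.2.le hcont
  have hmem : -kickAngle κ θ₁ ∈ Icc (kickAngle κ θ₁) (kickAngle κ π) := by
    rw [kickAngle_pi]
    exact ⟨by linarith, by linarith⟩
  obtain ⟨θ₂, hθ₂, heq⟩ := hivt hmem
  have hne : θ₁ ≠ θ₂ := by
    rintro rfl
    linarith
  have hθ₂pi : θ₂ ≠ π := by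
    rintro rfl
    rw [kickAngle_pi] at heq
    linarith
  refine ⟨θ₁, hθ₁, θ₂, ⟨hθ₁.1.trans_le hθ₂.1, lt_of_le_of_ne hθ₂.2 hθ₂pi⟩, hne, heq, hneg⟩

end Summit.Ventures.LatticeQCDFlow.Exactness

end
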